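import Summits.Ventures.LatticeQCDFlow.Scoring.ChainTauIntVarianceEstimator

/-!
# THE POLARISED Γ-METHOD FOR TWO WINDOW FUNCTIONALS ON MARKOV-CHAIN DATA: `gammaCross (φ ∘ Y) (ψ ∘ Y)`
# is a consistent estimator of the long-run CROSS covariance
# `½ (σ²(φ + ψ) − σ²(φ) − σ²(ψ))` of the two series, from EVERY initial law

HONEST FRAMING: exact (Metropolis-corrected) sampling algorithms for lattice gauge theory;
figures of merit are autocorrelation/cost numbers at stated couplings and volumes; no
continuum-physics claim.

Venture `LatticeQCDFlow` (cell pub-lqcd), sub-topic `Scoring`; FANOUT row 16 (`su2-base`), GEN-10.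
NEW WORK of the cell, not a published result; no definition is introduced; nothing is cited as a fact.
GEN-10's `Scoring/ChainTauIntVarianceEstimator` polarised the Γ-method at the lag-product series to
estimate Bartlett's matrix; the same three-series trick works for ANY two bounded window functionals
`φ, ψ` of `W + 1` consecutive states (e.g. the acceptance indicator and an observable increment; two
observables' lag products; an observable and its square): scorer A's windowed statistic applied to
`u = φ ∘ Y`, `v = ψ ∘ Y` and `u + v` and combined as `gammaCross u v N K_N = ½ (V(u+v) − V(u) − V(v))`
converges in probability, for truncations `K_N → ∞`, `K_N³/N → 0`, to the POLARISED long-run variance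
`½ (windowLRVar(φ+ψ) − windowLRVar(φ) − windowLRVar(ψ))` — the long-run cross covariance of the two
series under `P_π` — from EVERY initial law (GEN-10's `ChainWindowGammaMethod` three times and the
in-measure algebra of `ChainTauIntVarianceEstimator`).

## Content (`κ` Markov, `π` invariant, `(nHit κ m)(z,·) ≥ ε ν` for all `z`, `ε ≠ 0`, `0 < m`;
## `φ, ψ : (Fin (W+1) → S) → ℝ` measurable and bounded; `K_N → ∞`, `K_N³/N → 0`; `μ₀` ANY initial law)

* **`chain_windowGammaCross_tendstoInMeasure_of_nHit`** — THE THEOREM above.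

NOT CLAIMED: the Green–Kubo cross-sum form of the limit (`E_π[φ̄ψ̄] + Σ_{k≥1}(E_π[φ̄_0 ψ̄_k] + E_π[ψ̄_0 φ̄_k])`,
equal to the polarised form by bilinearity — not typed here); the automatic window; rates.
-/

noncomputable section

open MeasureTheory ProbabilityTheory Filter Finset Preorder
open scoped ENNReal NNReal Topology
open Summit.Ventures.LatticeQCDFlow.Exactness Summit.Ventures.LatticeQCDFlow.Exactness.GeneralNCMC

namespace Summit.Ventures.LatticeQCDFlow.Scoring

variable {S : Type*} [MeasurableSpace S]
variable (κ : Kernel S S) [IsMarkovKernel κ] (W : ℕ) {π : Measure S} [IsProbabilityMeasure π]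
  {ν : Measure S} [IsProbabilityMeasure ν] {ε : ℝ≥0∞} {m : ℕ}

/-- **THE POLARISED Γ-METHOD ESTIMATES THE LONG-RUN CROSS COVARIANCE OF TWO WINDOW FUNCTIONALS, FROM
EVERY INITIAL LAW.**  `κ` Markov with invariant probability `π`, `(nHit κ m)(z, ·) ≥ ε ν` for all `z`
(`ε ≠ 0`, `0 < m`); `φ, ψ` bounded measurable functions of `W + 1` consecutive states; truncations
`K_N → ∞`, `K_N³/N → 0`.  Then under `P_{μ₀}`, for EVERY `μ₀`:
`gammaCross (φ ∘ Y) (ψ ∘ Y) N K_N → ½ (windowLRVar κ π W (φ+ψ) − windowLRVar κ π W φ − windowLRVar κ π W ψ)`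
in measure. -/
theorem chain_windowGammaCross_tendstoInMeasure_of_nHit (hπ : Kernel.Invariant κ π) (hε : ε ≠ 0)
    (hmin : ∀ z, ε • ν ≤ nHit κ m z) (hm : 0 < m)
    {φ ψ : (Fin (W + 1) → S) → ℝ} (hφ : Measurable φ) (hψ : Measurable ψ) {Cφ Cψ : ℝ}
    (hCφ : ∀ v, |φ v| ≤ Cφ) (hCψ : ∀ v, |ψ v| ≤ Cψ)
    {K : ℕ → ℕ} (hK : Tendsto K atTop atTop) (hK3 : Tendsto (fun N => (K N : ℝ) ^ 3 / N) atTop (𝓝 0))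
    (μ₀ : Measure S) [IsProbabilityMeasure μ₀] :
    TendstoInMeasure (Kernel.trajMeasure (X := fun _ : ℕ => S) μ₀
        (fun n : ℕ => κ.comap (fun hh : (i : ↥(Finset.Iic n)) → S => hh ⟨n, Finset.mem_Iic.2 le_rfl⟩)
          (measurable_pi_apply _)))
      (fun (N : ℕ) (x : ℕ → S) =>
        gammaCross (fun i => φ (windowPath W x i)) (fun i => ψ (windowPath W x i)) N (K N))
      atTop (fun _ => (windowLRVar κ π W (fun y => φ y + ψ y) - windowLRVar κ π W φ
        - windowLRVar κ π W ψ) / 2) := by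
  have hsum : ∀ v, |φ v + ψ v| ≤ Cφ + Cψ := fun v =>
    (abs_add_le _ _).trans (add_le_add (hCφ v) (hCψ v))
  have h1 := chain_windowGammaWindow_tendstoInMeasure_of_nHit κ W hπ hε hmin hm (hφ.add hψ) hsum hK hK3 μ₀
  have h2 := chain_windowGammaWindow_tendstoInMeasure_of_nHit κ W hπ hε hmin hm hφ hCφ hK hK3 μ₀
  have h3 := chain_windowGammaWindow_tendstoInMeasure_of_nHit κ W hπ hε hmin hm hψ hCψ hK hK3 μ₀
  have h := tendstoInMeasure_div_const_lim (tendstoInMeasure_sub_lim (tendstoInMeasure_sub_lim h1 h2) h3) 2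
  exact h

end Summit.Ventures.LatticeQCDFlow.Scoring

end
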